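import Literature.Analysis.FluidPDE.StationaryEulerPlanarLaminates
import HarnessLib

/-!
# The planar relaxed sets `𝒱_r` and `𝒰_r = 𝒱_r^{lc}` (Choffrut–Székelyhidi 2014, §5.3)

Topic `Literature/Analysis/FluidPDE`. Support file of the proof of
`Literature.Analysis.FluidPDE.Torus.ChoffrutSzekelyhidi2014_thm1` (Choffrut–Székelyhidi, SIAM
J. Math. Anal. 46 (2014) = arXiv:1401.4301), §5.3, (5.9):
`𝒱_r = {R_θ(z, c) : (z, c) ∈ V_r, 0 < |c| < r/2}` and `𝒰_r := 𝒱_r^{lc}`.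

Here `𝒱_r` is defined *invariantly*: for an admissible state `w = (z, ζ)` with `ζ ≠ 0` write
`ρ = |ζ|`, `a' = √((|z|² + Re(z²ζ̄)/|ζ|)/2)`, `b' = √((|z|² - Re(z²ζ̄)/|ζ|)/2)` (the moduli of the
coordinates of `z` in the frame rotating `ζ` to the positive real axis) and
`F_r(w) = √r a'/(r/2 + ρ) + √r b'/(r/2 - ρ)`; then `𝒱_r = {w admissible : 0 < ρ < r/2, F_r(w) < 1}`
(`F_r(R_θ(a, b, c)) = f_r(a, b, c)` for `c ≠ 0`). This makes the (relative, joint in `r`)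
openness of Prop. 15 (i) a matter of continuity, and the rotation `R_θ` with `w = R_θ(a', b', ρ)`
is produced by half-angle formulas. Main results:

* `rot_decomp` — every admissible `w` with `ζ ≠ 0` is `R_θ(a, b, ρ)` with `|a| = a'`, `|b| = b'`;
* `frfun_lt_one_of_mem_Wplane` — **Prop. 14 (iii)**: `V̄_{r'} ⊆ V_r` for `0 < r' < r`;
* `rot_mem_U_of_mem_Wplane` — `R_θ V̄_{r'} ⊆ 𝒰_r` (points with `c = 0` through a vertical
  wave segment, "we nevertheless have `V_r ⊆ 𝒰_r`");
* `isRelOpen_calV`, `calV_mono` — Prop. 15 (i) and monotonicity in `r`;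
* `K_subset_U2` — property (*) (Prop. 15 (ii) in the form needed): `𝒦_{r'} ⊆ 𝒰_r`, `0 ≤ r' < r`;
* `calV_subset_C` — `𝒱_r ⊆ 𝒦_r^{co}` (barycentres of the laminates of Prop. 14 (iv)).

## References

* A. Choffrut, L. Székelyhidi Jr., SIAM J. Math. Anal. 46 (2014), §5.2–5.3, Props. 14, 15.
-/

noncomputable section

open scoped InnerProductSpace Matrix Topology
open Set Function Metric Filter

namespace Literature.Analysis.FluidPDE

namespace StationaryEuler

section HullMono

variable {d : Type*} [Fintype d] [DecidableEq d]

/-- `lcSucc` is monotone in the set. [folklore] -/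
theorem lcSucc_mono_set {U U' : Set (State d)} (h : U ⊆ U') : lcSucc U ⊆ lcSucc U' := by
  rintro x (hx | ⟨ξ, hξ, ξ', hξ', hw, hx⟩)
  · exact Or.inl (h hx)
  · exact Or.inr ⟨ξ, h hξ, ξ', h hξ', hw, hx⟩

/-- `lcIter` is monotone in the set. [folklore] -/
theorem lcIter_mono_set {U U' : Set (State d)} (h : U ⊆ U') (n : ℕ) : lcIter U n ⊆ lcIter U' n := by
  induction n with
  | zero => exact h
  | succ n ih => exact lcSucc_mono_set ih

/-- **The lamination convex hull is monotone in the set.** [folklore] -/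
theorem lcHull_mono {U U' : Set (State d)} (h : U ⊆ U') : lcHull U ⊆ lcHull U' :=
  Set.iUnion_mono fun n => lcIter_mono_set h n

/-- **Validity in a hull from the atoms**: a laminate valid somewhere, all of whose atoms lie in
`U'`, is valid in `U'^{lc}` (its splitting segments are wave segments between barycentres of
sub-laminates, which lie in the hull inductively). [cite: ChoffrutSzekelyhidi2014, Def. 8, Lemma 9] -/
theorem Laminate.isValid_lcHull_of_allAtoms {S U' : Set (State d)} {T : Laminate d} (hT : T.IsValid S)
    (hA : T.AllAtoms (· ∈ U')) : T.IsValid (lcHull U') := by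
  induction T with
  | atom w => exact subset_lcHull U' hA
  | split t η q l r ihl ihr =>
    obtain ⟨ht0, ht1, hη, hv, hu, -, hl, hr⟩ := hT
    have hl' := ihl hl hA.1
    have hr' := ihr hr hA.2
    refine ⟨ht0, ht1, hη, hv, hu, ?_, hl', hr'⟩
    exact segment_subset_lcHull hl'.bary_mem hr'.bary_mem ⟨η, q, hη, hv, hu⟩

end HullMono

namespace Frame2

variable {d : Type*} [Fintype d] [DecidableEq d] (φ : Frame2 d)

/-! ## The invariant functions -/

/-- `ρ = |ζ| = √(c² + e²)`. [cite: ChoffrutSzekelyhidi2014, §5.3] -/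
def rho (w : State d) : ℝ := Real.sqrt (φ.cc w ^ 2 + φ.ce w ^ 2)

/-- `Re(z² ζ̄) = (a² - b²) c + 2ab e`. [cite: ChoffrutSzekelyhidi2014, §5.1] -/
def Pz (w : State d) : ℝ := (φ.ca w ^ 2 - φ.cb w ^ 2) * φ.cc w + 2 * φ.ca w * φ.cb w * φ.ce w

/-- `a' = √((|z|² + Re(z²ζ̄)/ρ)/2)`. [cite: ChoffrutSzekelyhidi2014, §5.3] -/
def ap (w : State d) : ℝ := Real.sqrt ((φ.ca w ^ 2 + φ.cb w ^ 2 + φ.Pz w / φ.rho w) / 2)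

/-- `b' = √((|z|² - Re(z²ζ̄)/ρ)/2)`. [cite: ChoffrutSzekelyhidi2014, §5.3] -/
def bp (w : State d) : ℝ := Real.sqrt ((φ.ca w ^ 2 + φ.cb w ^ 2 - φ.Pz w / φ.rho w) / 2)

/-- **`F_r(w) = √r a'/(r/2 + ρ) + √r b'/(r/2 - ρ)`**, the rotation-invariant form of `f_r` of (5.3).
[cite: ChoffrutSzekelyhidi2014, (5.3), (5.9)] -/
def Ffun (r : ℝ) (w : State d) : ℝ := Real.sqrt r * φ.ap w / (r / 2 + φ.rho w) + Real.sqrt r * φ.bp w / (r / 2 - φ.rho w)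

/-- `f_r(a, b, c) = √r|a|/(r/2 + c) + √r|b|/(r/2 - c)` ((5.3)). [cite: ChoffrutSzekelyhidi2014, (5.3)] -/
def frfun (r a b c : ℝ) : ℝ := Real.sqrt r * |a| / (r / 2 + c) + Real.sqrt r * |b| / (r / 2 - c)

/-- **`𝒱_r`** of (5.9), invariantly: admissible, `0 < ρ < r/2`, `F_r < 1`. [cite: ChoffrutSzekelyhidi2014, (5.9)] -/
def calV (r : ℝ) : Set (State d) := {w | IsAdm w ∧ 0 < φ.rho w ∧ φ.rho w < r / 2 ∧ φ.Ffun r w < 1}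

/-- **`𝒰_r := 𝒱_r^{lc}`** of (5.9). [cite: ChoffrutSzekelyhidi2014, (5.9)] -/
def U2 (r : ℝ) : Set (State d) := lcHull (φ.calV r)

/-! ## Values on rotated `L`-points -/

/-- The invariant functions on `R_θ(a, b, c)`: `ρ = |c|`. [folklore] -/
theorem rho_rot {κ l : ℝ} (hκl : κ ^ 2 + l ^ 2 = 1) (a b c : ℝ) : φ.rho (φ.rot κ l a b c 0) = |c| := by
  rw [rho, rot, cc_mk4, ce_mk4, ← Real.sqrt_sq_eq_abs]
  congr 1
  have : (κ ^ 2 + l ^ 2) ^ 2 = 1 := by rw [hκl]; norm_num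
  linear_combination c ^ 2 * this

/-- `Re(z²ζ̄)` on `R_θ(a, b, c)`: `(a² - b²) c`. [folklore] -/
theorem Pz_rot {κ l : ℝ} (hκl : κ ^ 2 + l ^ 2 = 1) (a b c : ℝ) : φ.Pz (φ.rot κ l a b c 0) = (a ^ 2 - b ^ 2) * c := by
  rw [Pz, rot, ca_mk4, cb_mk4, cc_mk4, ce_mk4]
  have : (κ ^ 2 + l ^ 2) ^ 2 = 1 := by rw [hκl]; norm_num
  linear_combination (a ^ 2 - b ^ 2) * c * this

/-- `|z|²` on `R_θ(a, b, c)`: `a² + b²`. [folklore] -/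
theorem normz_rot {κ l : ℝ} (hκl : κ ^ 2 + l ^ 2 = 1) (a b c e : ℝ) :
    φ.ca (φ.rot κ l a b c e) ^ 2 + φ.cb (φ.rot κ l a b c e) ^ 2 = a ^ 2 + b ^ 2 := by
  rw [rot, ca_mk4, cb_mk4]
  linear_combination (a ^ 2 + b ^ 2) * hκl

/-- `a'`, `b'` on `R_θ(a, b, c)` with `c > 0`: `|a|`, `|b|`. [folklore] -/
theorem ap_rot_pos {κ l : ℝ} (hκl : κ ^ 2 + l ^ 2 = 1) (a b : ℝ) {c : ℝ} (hc : 0 < c) :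
    φ.ap (φ.rot κ l a b c 0) = |a| ∧ φ.bp (φ.rot κ l a b c 0) = |b| := by
  rw [ap, bp, normz_rot _ hκl, Pz_rot _ hκl, rho_rot _ hκl, abs_of_pos hc, mul_div_assoc, div_self hc.ne', mul_one]
  constructor
  · rw [show (a ^ 2 + b ^ 2 + (a ^ 2 - b ^ 2)) / 2 = a ^ 2 by ring, Real.sqrt_sq_eq_abs]
  · rw [show (a ^ 2 + b ^ 2 - (a ^ 2 - b ^ 2)) / 2 = b ^ 2 by ring, Real.sqrt_sq_eq_abs]

/-- `a'`, `b'` on `R_θ(a, b, c)` with `c < 0`: `|b|`, `|a|`. [folklore] -/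
theorem ap_rot_neg {κ l : ℝ} (hκl : κ ^ 2 + l ^ 2 = 1) (a b : ℝ) {c : ℝ} (hc : c < 0) :
    φ.ap (φ.rot κ l a b c 0) = |b| ∧ φ.bp (φ.rot κ l a b c 0) = |a| := by
  rw [ap, bp, normz_rot _ hκl, Pz_rot _ hκl, rho_rot _ hκl, abs_of_neg hc, mul_div_assoc, div_neg, div_self hc.ne]
  constructor
  · rw [show (a ^ 2 + b ^ 2 + (a ^ 2 - b ^ 2) * -1) / 2 = b ^ 2 by ring, Real.sqrt_sq_eq_abs]
  · rw [show (a ^ 2 + b ^ 2 - (a ^ 2 - b ^ 2) * -1) / 2 = a ^ 2 by ring, Real.sqrt_sq_eq_abs]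

/-- **`F_r(R_θ(a, b, c)) = f_r(a, b, c)`** for `c ≠ 0`. [cite: ChoffrutSzekelyhidi2014, (5.9)] -/
theorem Ffun_rot {κ l : ℝ} (hκl : κ ^ 2 + l ^ 2 = 1) (r a b : ℝ) {c : ℝ} (hc : c ≠ 0) :
    φ.Ffun r (φ.rot κ l a b c 0) = frfun r a b c := by
  rcases lt_or_gt_of_ne hc with hc' | hc'
  · obtain ⟨h1, h2⟩ := φ.ap_rot_neg hκl a b hc'
    rw [Ffun, h1, h2, rho_rot _ hκl, abs_of_neg hc', frfun, sub_neg_eq_add, ← sub_eq_add_neg, add_comm]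
  · obtain ⟨h1, h2⟩ := φ.ap_rot_pos hκl a b hc'
    rw [Ffun, h1, h2, rho_rot _ hκl, abs_of_pos hc', frfun]

/-! ## The rotation decomposition -/

/-- **Half-angle rotation**: an admissible state with `ζ ≠ 0` is `R_θ(a, b, ρ)` for the rotation by
`θ = arg(ζ)/2` (`κ = √((1 + c/ρ)/2)`, `λ = e/(2ρκ)`, or `(0, 1)` if `κ = 0`) and
`(a, b) = R_{-θ} z`; moreover `|a| = a'(w)`, `|b| = b'(w)`. [cite: ChoffrutSzekelyhidi2014, §5.3] -/
theorem rot_decomp {w : State d} (hw : IsAdm w) (hρ : 0 < φ.rho w) :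
    ∃ κ l a b : ℝ, κ ^ 2 + l ^ 2 = 1 ∧ w = φ.rot κ l a b (φ.rho w) 0 ∧ |a| = φ.ap w ∧ |b| = φ.bp w := by
  set c := φ.cc w with hc
  set e := φ.ce w with he
  set ρ := φ.rho w with hρdef
  have hρ2 : ρ ^ 2 = c ^ 2 + e ^ 2 := by rw [hρdef, rho]; exact Real.sq_sqrt (by positivity)
  set u := c / ρ with hu
  set s := e / ρ with hs
  have hus : u ^ 2 + s ^ 2 = 1 := by
    rw [hu, hs, div_pow, div_pow, ← add_div, ← hρ2, div_self (pow_ne_zero _ hρ.ne')]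
  have hu1 : -1 ≤ u := by nlinarith [sq_nonneg s, sq_nonneg (u + 1)]
  have hu1' : u ≤ 1 := by nlinarith [sq_nonneg s, sq_nonneg (u - 1)]
  set κ := Real.sqrt ((1 + u) / 2) with hκ
  have hκ2 : κ ^ 2 = (1 + u) / 2 := Real.sq_sqrt (by linarith)
  have hκ0 : 0 ≤ κ := Real.sqrt_nonneg _
  -- the rotation
  obtain ⟨l, hκl, hcos, hsin⟩ : ∃ l : ℝ, κ ^ 2 + l ^ 2 = 1 ∧ κ ^ 2 - l ^ 2 = u ∧ 2 * κ * l = s := by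
    by_cases hk : κ = 0
    · have hu0 : u = -1 := by rw [hk] at hκ2; linarith
      have hs0 : s = 0 := by rw [hu0] at hus; nlinarith
      exact ⟨1, by rw [hk]; norm_num, by rw [hk, hu0]; norm_num, by rw [hk, hs0]; norm_num⟩
    · have hkpos : 0 < κ := lt_of_le_of_ne hκ0 (Ne.symm hk)
      refine ⟨s / (2 * κ), ?_, ?_, ?_⟩
      · have : (s / (2 * κ)) ^ 2 = (1 - u) / 2 := by
          rw [div_pow, mul_pow]
          field_simp
          nlinarith [hus, hκ2]
        rw [this, hκ2]; ring
      · have : (s / (2 * κ)) ^ 2 = (1 - u) / 2 := by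
          rw [div_pow, mul_pow]
          field_simp
          nlinarith [hus, hκ2]
        rw [this, hκ2]; ring
      · field_simp
  -- the planar coordinates
  set a := κ * φ.ca w + l * φ.cb w with ha
  set b := -l * φ.ca w + κ * φ.cb w with hb
  have hcρ : c = u * ρ := by rw [hu]; field_simp
  have heρ : e = s * ρ := by rw [hs]; field_simp
  have hw_eq : w = φ.rot κ l a b ρ 0 := by
    rw [φ.eq_mk4 hw, rot]
    congr 1
    · rw [ha, hb]; linear_combination (-(φ.ca w)) * hκl
    · rw [ha, hb]; linear_combination (-(φ.cb w)) * hκl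
    · rw [← hc, hcρ, ← hcos]; ring
    · rw [← he, heρ, ← hsin]; ring
  refine ⟨κ, l, a, b, hκl, hw_eq, ?_, ?_⟩
  · have h := (φ.ap_rot_pos hκl a b hρ).1
    rw [← hw_eq] at h
    exact h.symm
  · have h := (φ.ap_rot_pos hκl a b hρ).2
    rw [← hw_eq] at h
    exact h.symm

/-! ## Proposition 14 (iii): `V̄_{r'} ⊆ V_r` -/

/-- The weights `√r/(r/2 ± c)` of `f_r` decrease in `r`. [cite: ChoffrutSzekelyhidi2014, Prop. 14 (iii)] -/
theorem weight_lt {r r' c : ℝ} (hr' : 0 < r') (hrr : r' < r) (hc : |c| < r' / 2) :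
    Real.sqrt r / (r / 2 + c) < Real.sqrt r' / (r' / 2 + c) ∧ Real.sqrt r / (r / 2 - c) < Real.sqrt r' / (r' / 2 - c) := by
  set p := Real.sqrt r with hp
  set q := Real.sqrt r' with hq
  have hr : 0 < r := hr'.trans hrr
  have hp2 : p ^ 2 = r := Real.sq_sqrt hr.le
  have hq2 : q ^ 2 = r' := Real.sq_sqrt hr'.le
  have hq0 : 0 < q := Real.sqrt_pos.2 hr'
  have hp0 : 0 < p := Real.sqrt_pos.2 hr
  have hqp : q < p := Real.sqrt_lt_sqrt hr'.le hrr
  have hc1 := (abs_lt.1 hc).1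
  have hc2 := (abs_lt.1 hc).2
  have hden1 : 0 < r / 2 + c := by linarith
  have hden2 : 0 < r' / 2 + c := by linarith
  have hden3 : 0 < r / 2 - c := by linarith
  have hden4 : 0 < r' / 2 - c := by linarith
  -- `c < q²/2 < pq/2` and `-pq/2 < -q²/2 < c`
  have hpq : q ^ 2 < p * q := by nlinarith
  constructor
  · rw [div_lt_div_iff₀ hden1 hden2, ← hp2, ← hq2]
    nlinarith [mul_pos hp0 hq0]
  · rw [div_lt_div_iff₀ hden3 hden4, ← hp2, ← hq2]
    nlinarith [mul_pos hp0 hq0]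

/-- **Proposition 14 (iii)**: `V̄_{r'} ⊆ V_r` for `0 < r' < r`, i.e. `f_r < 1` on `V̄_{r'}`.
[cite: ChoffrutSzekelyhidi2014, Prop. 14 (iii)] -/
theorem frfun_lt_one_of_mem_Wplane {r r' a b c : ℝ} (hr' : 0 < r') (hrr : r' < r) (hp : (a, b, c) ∈ Wplane r') :
    frfun r a b c < 1 := by
  obtain ⟨hc, hn, hg⟩ := hp
  simp only at hc hn hg
  have hr : 0 < r := hr'.trans hrr
  set p := Real.sqrt r with hpdef
  set q := Real.sqrt r' with hqdef
  have hp2 : p ^ 2 = r := Real.sq_sqrt hr.le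
  have hq2 : q ^ 2 = r' := Real.sq_sqrt hr'.le
  have hq0 : 0 < q := Real.sqrt_pos.2 hr'
  have hp0 : 0 < p := Real.sqrt_pos.2 hr
  have hqp : q < p := Real.sqrt_lt_sqrt hr'.le hrr
  rcases (abs_le.1 hc) with ⟨hc1, hc2⟩
  by_cases hcs : |c| < r' / 2
  · -- interior slice: termwise comparison
    have hA := Ac_pos hr' hcs
    have hB := Bc_pos hr' hcs
    rw [gfun_eq hr'] at hg
    have hle : |a| * Bc r' c + |b| * Ac r' c ≤ Ac r' c * Bc r' c := by nlinarith
    -- `f_{r'} ≤ 1`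
    have hf' : q * |a| / (r' / 2 + c) + q * |b| / (r' / 2 - c) ≤ 1 := by
      have e1 : q * |a| / (r' / 2 + c) = |a| / Ac r' c := by
        rw [Ac, hqdef]; field_simp
      have e2 : q * |b| / (r' / 2 - c) = |b| / Bc r' c := by
        rw [Bc, hqdef]; field_simp
      rw [e1, e2, div_add_div _ _ hA.ne' hB.ne', div_le_one (mul_pos hA hB)]
      linarith
    by_cases hab : |a| + |b| = 0
    · have ha : a = 0 := abs_eq_zero.1 (by linarith [abs_nonneg a, abs_nonneg b])
      have hb : b = 0 := abs_eq_zero.1 (by linarith [abs_nonneg a, abs_nonneg b])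
      rw [frfun, ha, hb, abs_zero, mul_zero, zero_div, zero_div, add_zero]
      exact zero_lt_one
    · obtain ⟨w1, w2⟩ := weight_lt hr' hrr hcs
      have hpos : 0 < |a| + |b| := lt_of_le_of_ne (by positivity) (Ne.symm hab)
      have hden2 : 0 < r' / 2 + c := by linarith [(abs_lt.1 hcs).1]
      have hden4 : 0 < r' / 2 - c := by linarith [(abs_lt.1 hcs).2]
      calc frfun r a b c = |a| * (p / (r / 2 + c)) + |b| * (p / (r / 2 - c)) := by rw [frfun, hpdef]; ring
        _ < |a| * (q / (r' / 2 + c)) + |b| * (q / (r' / 2 - c)) := by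
            rcases (abs_nonneg a).lt_or_eq with ha | ha
            · exact add_lt_add_of_lt_of_le (mul_lt_mul_of_pos_left w1 ha)
                (mul_le_mul_of_nonneg_left w2.le (abs_nonneg b))
            · have hb : 0 < |b| := by rw [← ha] at hpos; linarith
              rw [← ha, zero_mul, zero_mul, zero_add, zero_add]
              exact mul_lt_mul_of_pos_left w2 hb
        _ = q * |a| / (r' / 2 + c) + q * |b| / (r' / 2 - c) := by ring
        _ ≤ 1 := hf'
  · -- the caps `c = ± r'/2`
    push Not at hcs
    have hceq : |c| = r' / 2 := le_antisymm hc hcs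
    have h2pq : 2 * p * q < p ^ 2 + q ^ 2 := by nlinarith [sq_nonneg (p - q)]
    rcases (abs_eq (by linarith : (0 : ℝ) ≤ r' / 2)).1 hceq with hc' | hc'
    · -- `c = r'/2`: `b = 0`, `|a| ≤ √r'`
      have hb : b = 0 := by
        unfold gfun at hg
        rw [hc', show r' / 2 - r' / 2 = 0 by ring, mul_zero, mul_zero, sub_zero, zero_add] at hg
        have : 0 ≤ Real.sqrt r' * |b| * (r' / 2 + r' / 2) := by positivity
        have h0 : Real.sqrt r' * |b| * (r' / 2 + r' / 2) = 0 := le_antisymm hg this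
        rw [show r' / 2 + r' / 2 = r' by ring] at h0
        have := mul_eq_zero.1 h0
        rcases this with h | h
        · rcases mul_eq_zero.1 h with h | h
          · exact absurd h hq0.ne'
          · exact abs_eq_zero.1 h
        · exact absurd h hr'.ne'
      have ha : |a| ≤ q := by
        rw [hb] at hn
        have : a ^ 2 ≤ q ^ 2 := by rw [hq2]; nlinarith
        exact abs_le_of_sq_le_sq' this hq0.le |>.2 |> fun h => abs_le.2 ⟨(abs_le_of_sq_le_sq' this hq0.le).1, h⟩
      rw [frfun, hb, hc', abs_zero, mul_zero, zero_div, add_zero, div_lt_one (by linarith), ← hpdef]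
      calc p * |a| ≤ p * q := mul_le_mul_of_nonneg_left ha hp0.le
        _ < r / 2 + r' / 2 := by rw [← hp2, ← hq2]; linarith
    · -- `c = -r'/2`: `a = 0`, `|b| ≤ √r'`
      have ha : a = 0 := by
        unfold gfun at hg
        rw [hc', show r' / 2 + -(r' / 2) = 0 by ring, mul_zero, zero_mul, sub_zero, add_zero] at hg
        have : 0 ≤ Real.sqrt r' * |a| * (r' / 2 - -(r' / 2)) := by
          have : 0 ≤ r' / 2 - -(r' / 2) := by linarith
          positivity
        have h0 : Real.sqrt r' * |a| * (r' / 2 - -(r' / 2)) = 0 := le_antisymm hg this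
        rw [show r' / 2 - -(r' / 2) = r' by ring] at h0
        rcases mul_eq_zero.1 h0 with h | h
        · rcases mul_eq_zero.1 h with h | h
          · exact absurd h hq0.ne'
          · exact abs_eq_zero.1 h
        · exact absurd h hr'.ne'
      have hb : |b| ≤ q := by
        rw [ha] at hn
        have : b ^ 2 ≤ q ^ 2 := by rw [hq2]; nlinarith
        exact abs_le.2 (abs_le_of_sq_le_sq' this hq0.le)
      rw [frfun, ha, hc', abs_zero, mul_zero, zero_div, zero_add, sub_neg_eq_add, div_lt_one (by linarith), ← hpdef]
      calc p * |b| ≤ p * q := mul_le_mul_of_nonneg_left hb hp0.le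
        _ < r / 2 + r' / 2 := by rw [← hp2, ← hq2]; linarith

/-! ## `R_θ V̄_{r'} ⊆ 𝒰_r` -/

variable {κ l : ℝ}

/-- Rotated `L`-points with `c ≠ 0` and `f_r < 1`, `|c| < r/2` lie in `𝒱_r`. [cite: ChoffrutSzekelyhidi2014, (5.9)] -/
theorem rot_mem_calV (hκl : κ ^ 2 + l ^ 2 = 1) {r a b c : ℝ} (hc0 : c ≠ 0) (hc : |c| < r / 2) (hf : frfun r a b c < 1) :
    φ.rot κ l a b c 0 ∈ φ.calV r := by
  refine ⟨φ.isAdm_rot κ l a b c 0, ?_, ?_, ?_⟩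
  · rw [rho_rot _ hκl]; exact abs_pos.2 hc0
  · rwa [rho_rot _ hκl]
  · rwa [Ffun_rot _ hκl r a b hc0]

/-- `𝒱_r ⊆ 𝒰_r`. [folklore] -/
theorem calV_subset_U2 (r : ℝ) : φ.calV r ⊆ φ.U2 r := subset_lcHull _

/-- **Rotated `L`-points with `c = 0`** and `f_r(a, b, 0) < 1` lie in `𝒱_r^{(1)} ⊆ 𝒰_r`: the midpoint
of the vertical wave segment `[R_θ(a, b, -δ), R_θ(a, b, δ)]`. [cite: ChoffrutSzekelyhidi2014, §5.3 ("we nevertheless have `V_r ⊆ 𝒰_r`")] -/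
theorem rot_mem_U2_of_c_zero (hκl : κ ^ 2 + l ^ 2 = 1) {r a b : ℝ} (hr : 0 < r) (hf : frfun r a b 0 < 1) :
    φ.rot κ l a b 0 0 ∈ φ.U2 r := by
  -- `f_r(a, b, 0) = 2(|a| + |b|)/√r < 1`; margin `gap = r/2 - √r(|a| + |b|) > 0`
  set p := Real.sqrt r with hp
  have hp0 : 0 < p := Real.sqrt_pos.2 hr
  have hp2 : p ^ 2 = r := Real.sq_sqrt hr.le
  have hsum : p * (|a| + |b|) < r / 2 := by
    rw [frfun, add_zero, sub_zero, ← hp, ← add_div, div_lt_one (by linarith)] at hf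
    linarith
  set δ : ℝ := (r / 2 - p * (|a| + |b|)) / 2 with hδ
  have hδ0 : 0 < δ := by rw [hδ]; linarith
  have hδr : δ < r / 2 := by
    rw [hδ]; nlinarith [mul_nonneg hp0.le (add_nonneg (abs_nonneg a) (abs_nonneg b))]
  have hmem : ∀ s : ℝ, |s| = δ → φ.rot κ l a b s 0 ∈ φ.calV r := by
    intro s hs
    have hs0 : s ≠ 0 := fun h => by rw [h, abs_zero] at hs; exact hδ0.ne' hs.symm |>.elim
    refine φ.rot_mem_calV hκl hs0 (by rw [hs]; exact hδr) ?_
    -- `f_r(a, b, s) ≤ √r(|a| + |b|)/(r/2 - δ) < 1`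
    have hs1 : -δ ≤ s := by rw [← hs]; exact neg_abs_le s
    have hs2 : s ≤ δ := by rw [← hs]; exact le_abs_self s
    have hd1 : 0 < r / 2 + s := by linarith
    have hd2 : 0 < r / 2 - s := by linarith
    have hd3 : 0 < r / 2 - δ := by linarith
    rw [frfun, ← hp]
    calc p * |a| / (r / 2 + s) + p * |b| / (r / 2 - s) ≤ p * |a| / (r / 2 - δ) + p * |b| / (r / 2 - δ) :=
          add_le_add (div_le_div_of_nonneg_left (mul_nonneg hp0.le (abs_nonneg a)) hd3 (by linarith))
            (div_le_div_of_nonneg_left (mul_nonneg hp0.le (abs_nonneg b)) hd3 (by linarith))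
      _ = p * (|a| + |b|) / (r / 2 - δ) := by ring
      _ < 1 := by rw [div_lt_one hd3, hδ]; linarith
  have h1 : φ.rot κ l a b δ 0 ∈ φ.calV r := hmem δ (abs_of_pos hδ0)
  have h2 : φ.rot κ l a b (-δ) 0 ∈ φ.calV r := hmem (-δ) (by rw [abs_neg, abs_of_pos hδ0])
  refine lcIter_subset_lcHull _ 1 (Or.inr ⟨_, h2, _, h1, ?_, ?_⟩)
  · rw [rot_sub, show δ - -δ = 2 * δ by ring, sub_self, sub_self, sub_self]
    exact φ.isWaveDir_rot_vert hκl _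
  · refine ⟨1 / 2, 1 / 2, by norm_num, by norm_num, by norm_num, ?_⟩
    nth_rewrite 2 [show (1 / 2 : ℝ) = 1 - 1 / 2 by norm_num]
    rw [rot_convex]
    congr 1 <;> ring

/-- **`R_θ V̄_{r'} ⊆ 𝒰_r`** for `0 < r' < r`. [cite: ChoffrutSzekelyhidi2014, Prop. 15 (iii) (proof)] -/
theorem rot_mem_U2_of_mem_Wplane (hκl : κ ^ 2 + l ^ 2 = 1) {r r' a b c : ℝ} (hr' : 0 < r') (hrr : r' < r)
    (hp : (a, b, c) ∈ Wplane r') : φ.rot κ l a b c 0 ∈ φ.U2 r := by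
  have hf := frfun_lt_one_of_mem_Wplane hr' hrr hp
  by_cases hc0 : c = 0
  · subst hc0; exact φ.rot_mem_U2_of_c_zero hκl (hr'.trans hrr) hf
  · exact φ.calV_subset_U2 r (φ.rot_mem_calV hκl hc0 (lt_of_le_of_lt hp.1 (by linarith)) hf)

/-- `R_θ V̄_{r'} ⊆ 𝒰_r` as sets. [folklore] -/
theorem Wrot_subset_U2 (hκl : κ ^ 2 + l ^ 2 = 1) {r r' : ℝ} (hr' : 0 < r') (hrr : r' < r) : φ.Wrot κ l r' ⊆ φ.U2 r := by
  rintro _ ⟨p, hp, rfl⟩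
  exact φ.rot_mem_U2_of_mem_Wplane hκl hr' hrr hp

/-! ## Openness and monotonicity -/

omit [DecidableEq d] in
/-- The coordinates are continuous. [folklore] -/
theorem continuous_coords [DecidableEq d] :
    Continuous φ.ca ∧ Continuous φ.cb ∧ Continuous φ.cc ∧ Continuous φ.ce := by
  refine ⟨?_, ?_, ?_, ?_⟩
  · exact (PiLp.continuous_apply 2 (fun _ : Idx d => ℝ) (Sum.inl φ.i₀))
  · exact (PiLp.continuous_apply 2 (fun _ : Idx d => ℝ) (Sum.inl φ.i₁))
  · exact (PiLp.continuous_apply 2 (fun _ : Idx d => ℝ) (Sum.inr (φ.i₀, φ.i₀)))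
  · exact (PiLp.continuous_apply 2 (fun _ : Idx d => ℝ) (Sum.inr (φ.i₀, φ.i₁)))

/-- `ρ` is continuous. [folklore] -/
theorem continuous_rho : Continuous φ.rho := by
  obtain ⟨_, _, hc, he⟩ := φ.continuous_coords
  exact Real.continuous_sqrt.comp ((hc.pow 2).add (he.pow 2))

/-- `Re(z²ζ̄)` is continuous. [folklore] -/
theorem continuous_Pz : Continuous φ.Pz := by
  obtain ⟨ha, hb, hc, he⟩ := φ.continuous_coords
  unfold Pz; fun_prop

/-- `(r, w) ↦ F_r(w)` is continuous at points with `ρ ≠ 0`, `ρ ≠ r/2`, `ρ ≠ -r/2`. [folklore] -/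
theorem continuousAt_Ffun {r : ℝ} {w : State d} (hρ0 : φ.rho w ≠ 0) (hρ1 : r / 2 + φ.rho w ≠ 0) (hρ2 : r / 2 - φ.rho w ≠ 0) :
    ContinuousAt (fun p : ℝ × State d => φ.Ffun p.1 p.2) (r, w) := by
  obtain ⟨ha, hb, hc, he⟩ := φ.continuous_coords
  have hρc : Continuous fun p : ℝ × State d => φ.rho p.2 := φ.continuous_rho.comp continuous_snd
  have hsq : Continuous fun p : ℝ × State d => φ.ca p.2 ^ 2 + φ.cb p.2 ^ 2 :=
    ((ha.comp continuous_snd).pow 2).add ((hb.comp continuous_snd).pow 2)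
  have hPzc : Continuous fun p : ℝ × State d => φ.Pz p.2 := φ.continuous_Pz.comp continuous_snd
  have hquot : ContinuousAt (fun p : ℝ × State d => φ.Pz p.2 / φ.rho p.2) (r, w) :=
    hPzc.continuousAt.div hρc.continuousAt hρ0
  have hap : ContinuousAt (fun p : ℝ × State d => φ.ap p.2) (r, w) :=
    Real.continuous_sqrt.continuousAt.comp ((hsq.continuousAt.add hquot).div_const 2)
  have hbp : ContinuousAt (fun p : ℝ × State d => φ.bp p.2) (r, w) :=
    Real.continuous_sqrt.continuousAt.comp ((hsq.continuousAt.sub hquot).div_const 2)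
  have hsr : Continuous fun p : ℝ × State d => Real.sqrt p.1 := Real.continuous_sqrt.comp continuous_fst
  have hd1 : ContinuousAt (fun p : ℝ × State d => p.1 / 2 + φ.rho p.2) (r, w) :=
    ((continuous_fst.div_const 2).add hρc).continuousAt
  have hd2 : ContinuousAt (fun p : ℝ × State d => p.1 / 2 - φ.rho p.2) (r, w) :=
    ((continuous_fst.div_const 2).sub hρc).continuousAt
  exact ((hsr.continuousAt.mul hap).div hd1 hρ1).add ((hsr.continuousAt.mul hbp).div hd2 hρ2)

/-- **Proposition 15 (i), jointly in `r`**: `{(r, w) : w ∈ 𝒱_r}` is open relatively to admissible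
states — given `w ∈ 𝒱_r` there is `δ > 0` with `w' ∈ 𝒱_{r'}` for all admissible `w'` with
`dist w' w < δ` and `|r' - r| < δ`. [cite: ChoffrutSzekelyhidi2014, Prop. 15 (i)] -/
theorem calV_jointly_open {r : ℝ} {w : State d} (hw : w ∈ φ.calV r) :
    ∃ δ > 0, ∀ r' w', |r' - r| < δ → IsAdm w' → dist w' w < δ → w' ∈ φ.calV r' := by
  obtain ⟨-, hρ0, hρr, hF⟩ := hw
  -- the open conditions near `(r, w)`
  have hρc : Continuous fun p : ℝ × State d => φ.rho p.2 := φ.continuous_rho.comp continuous_snd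
  have hO1 : {p : ℝ × State d | 0 < φ.rho p.2} ∩ {p : ℝ × State d | φ.rho p.2 < p.1 / 2} ∈ 𝓝 (r, w) :=
    (IsOpen.inter (isOpen_lt continuous_const hρc) (isOpen_lt hρc (continuous_fst.div_const 2))).mem_nhds ⟨hρ0, hρr⟩
  have hO2 : (fun p : ℝ × State d => φ.Ffun p.1 p.2) ⁻¹' Iio 1 ∈ 𝓝 (r, w) :=
    (φ.continuousAt_Ffun hρ0.ne' (by linarith) (by linarith)).preimage_mem_nhds (Iio_mem_nhds hF)
  obtain ⟨δ, hδ, hball⟩ := Metric.mem_nhds_iff.1 (Filter.inter_mem hO1 hO2)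
  refine ⟨δ / 2, half_pos hδ, fun r' w' hr hw' hd => ?_⟩
  have hdist : dist (r', w') (r, w) < δ := by
    rw [Prod.dist_eq]
    refine max_lt ?_ (by linarith)
    rw [Real.dist_eq]; linarith
  obtain ⟨⟨h1, h2⟩, h3⟩ := hball (mem_ball.2 hdist)
  exact ⟨hw', h1, h2, h3⟩

/-- `𝒱_r` is relatively open. [cite: ChoffrutSzekelyhidi2014, Prop. 15 (i)] -/
theorem isRelOpen_calV (r : ℝ) : IsRelOpen (φ.calV r) := by
  intro w hw
  obtain ⟨δ, hδ, h⟩ := φ.calV_jointly_open hw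
  exact ⟨δ, hδ, fun w' hw' hd => h r w' (by simp [hδ]) hw' hd⟩

omit [DecidableEq d] in
/-- `𝒱_r` consists of admissible states. [folklore] -/
theorem calV_subset_Adm (r : ℝ) : φ.calV r ⊆ Adm := fun _ hw => hw.1

/-- **`𝒰_r` is relatively open** (Lemma 9). [cite: ChoffrutSzekelyhidi2014, Prop. 15 (i), Lemma 9] -/
theorem isRelOpen_U2 (r : ℝ) : IsRelOpen (φ.U2 r) := isRelOpen_lcHull (φ.calV_subset_Adm r) (φ.isRelOpen_calV r)

/-- The weights of `F_r` are antitone in `r` (non-strict). [folklore] -/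
theorem weight_le {r r' ρ : ℝ} (hr' : 0 < r') (hrr : r' ≤ r) (hρ0 : 0 ≤ ρ) (hρ : ρ < r' / 2) :
    Real.sqrt r / (r / 2 + ρ) ≤ Real.sqrt r' / (r' / 2 + ρ) ∧ Real.sqrt r / (r / 2 - ρ) ≤ Real.sqrt r' / (r' / 2 - ρ) := by
  rcases hrr.lt_or_eq with hlt | heq
  · have := weight_lt hr' hlt (c := ρ) (by rw [abs_of_nonneg hρ0]; exact hρ)
    exact ⟨this.1.le, this.2.le⟩
  · subst heq; exact ⟨le_rfl, le_rfl⟩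

omit [DecidableEq d] in
/-- **`𝒱_r` increases with `r`.** [cite: ChoffrutSzekelyhidi2014, Prop. 14 (iii)] -/
theorem calV_mono {r r' : ℝ} (hrr : r' ≤ r) : φ.calV r' ⊆ φ.calV r := by
  rintro w ⟨hw, hρ0, hρr, hF⟩
  have hr' : 0 < r' := by linarith
  refine ⟨hw, hρ0, by linarith, lt_of_le_of_lt ?_ hF⟩
  obtain ⟨w1, w2⟩ := weight_le hr' hrr hρ0.le hρr
  have hap : 0 ≤ φ.ap w := Real.sqrt_nonneg _
  have hbp : 0 ≤ φ.bp w := Real.sqrt_nonneg _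
  calc φ.Ffun r w = φ.ap w * (Real.sqrt r / (r / 2 + φ.rho w)) + φ.bp w * (Real.sqrt r / (r / 2 - φ.rho w)) := by
        rw [Ffun]; ring
    _ ≤ φ.ap w * (Real.sqrt r' / (r' / 2 + φ.rho w)) + φ.bp w * (Real.sqrt r' / (r' / 2 - φ.rho w)) :=
        add_le_add (mul_le_mul_of_nonneg_left w1 hap) (mul_le_mul_of_nonneg_left w2 hbp)
    _ = φ.Ffun r' w := by rw [Ffun]; ring

/-- **`𝒰_r` increases with `r`.** [folklore] -/
theorem U2_mono {r r' : ℝ} (hrr : r' ≤ r) : φ.U2 r' ⊆ φ.U2 r := lcHull_mono (φ.calV_mono hrr)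

/-! ## `𝒦_{r'} ⊆ 𝒰_r` and `𝒱_r ⊆ 𝒦_r^{co}` -/

/-- **Points of `𝒦_{r'}` lie in `𝒱_r`** for `0 < r' < r` (`ρ = r'/2`, `a' = √r'`, `b' = 0`,
`F_r = 2√(rr')/(r + r') < 1`). [cite: ChoffrutSzekelyhidi2014, Prop. 15 (ii)] -/
theorem mem_calV_of_mem_K {r r' : ℝ} (hr' : 0 < r') (hrr : r' < r) {w : State d} (hw : w ∈ K r') : w ∈ φ.calV r := by
  haveI : Nonempty d := ⟨φ.i₀⟩
  have hadm := isAdm_of_mem_K hw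
  obtain ⟨hv, hstr⟩ := hw
  -- coordinates: `c = (a² - b²)/2`, `e = ab`, `a² + b² = r'`
  set a := φ.ca w with ha
  set b := φ.cb w with hb
  have hva : vel w φ.i₀ = a := rfl
  have hvb : vel w φ.i₁ = b := rfl
  have hab : a ^ 2 + b ^ 2 = r' := by
    rw [← hv, EuclideanSpace.real_norm_sq_eq, φ.sum_eq, hva, hvb]
  have hc : φ.cc w = (a ^ 2 - b ^ 2) / 2 := by
    have h0 : φ.cc w = str w φ.i₀ φ.i₀ := rfl
    rw [h0, hstr, Matrix.sub_apply, Matrix.smul_apply, Matrix.one_apply_eq, φ.card_eq, tensorSelf, Matrix.vecMulVec_apply, hva]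
    simp only [smul_eq_mul, mul_one, Nat.cast_ofNat]
    rw [← hab]; ring
  have he : φ.ce w = a * b := by
    have h0 : φ.ce w = str w φ.i₀ φ.i₁ := rfl
    rw [h0, hstr, Matrix.sub_apply, Matrix.smul_apply, Matrix.one_apply_ne φ.ne, tensorSelf, Matrix.vecMulVec_apply, hva, hvb]
    simp
  have hρ : φ.rho w = r' / 2 := by
    rw [rho, hc, he, show ((a ^ 2 - b ^ 2) / 2) ^ 2 + (a * b) ^ 2 = ((a ^ 2 + b ^ 2) / 2) ^ 2 by ring, hab,
      Real.sqrt_sq (by linarith)]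
  have hP : φ.Pz w = r' ^ 2 / 2 := by
    rw [Pz, hc, he]
    show (a ^ 2 - b ^ 2) * ((a ^ 2 - b ^ 2) / 2) + 2 * a * b * (a * b) = r' ^ 2 / 2
    rw [← hab]; ring
  have hap : φ.ap w = Real.sqrt r' := by
    rw [ap, hP, hρ]
    congr 1
    show (a ^ 2 + b ^ 2 + r' ^ 2 / 2 / (r' / 2)) / 2 = r'
    rw [hab]; field_simp; ring
  have hbp : φ.bp w = 0 := by
    rw [bp, hP, hρ]
    convert Real.sqrt_zero using 2
    show (a ^ 2 + b ^ 2 - r' ^ 2 / 2 / (r' / 2)) / 2 = 0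
    rw [hab]; field_simp; ring
  refine ⟨hadm, by rw [hρ]; linarith, by rw [hρ]; linarith, ?_⟩
  rw [Ffun, hap, hbp, hρ, mul_zero, zero_div, add_zero, div_lt_one (by linarith)]
  have hr : 0 < r := hr'.trans hrr
  have h2 : 2 * Real.sqrt r * Real.sqrt r' < r + r' := by
    have hne : Real.sqrt r ≠ Real.sqrt r' := fun h => by
      have := congrArg (· ^ 2) h; simp only [Real.sq_sqrt hr.le, Real.sq_sqrt hr'.le] at this; linarith
    nlinarith [sq_pos_of_ne_zero (sub_ne_zero.2 hne), Real.sq_sqrt hr.le, Real.sq_sqrt hr'.le]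
  linarith

/-- **Property (*)**: `𝒦_{r'} ⊆ 𝒰_r` for `0 ≤ r' < r` (for `r' = 0`, `𝒦_0 = {0}` is the midpoint of a
vertical wave segment in `𝒱_r`). [cite: ChoffrutSzekelyhidi2014, Cor. 16] -/
theorem K_subset_U2 {r r' : ℝ} (hr'0 : 0 ≤ r') (hrr : r' < r) : K r' ⊆ φ.U2 r := by
  haveI : Nonempty d := ⟨φ.i₀⟩
  intro w hw
  rcases hr'0.lt_or_eq with hpos | hzero
  · exact φ.calV_subset_U2 r (φ.mem_calV_of_mem_K hpos hrr hw)
  · -- `r' = 0`: `w = 0 = R(0, 0, 0)`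
    subst hzero
    have hr : 0 < r := hrr
    have hw0 : w = φ.rot 1 0 0 0 0 0 := by
      obtain ⟨hv, hstr⟩ := hw
      have hvel : vel w = 0 := by
        have : ‖vel w‖ = 0 := by nlinarith [norm_nonneg (vel w), hv]
        exact norm_eq_zero.1 this
      have hs : str w = 0 := by rw [hstr, hvel, zero_div, zero_smul, sub_zero]; ext i j; simp [tensorSelf, Matrix.vecMulVec_apply]
      rw [φ.eq_mk4 (isAdm_of_mem_K ⟨hv, hstr⟩), rot]
      simp only [ca, cb, cc, ce, hvel, hs, PiLp.zero_apply, Matrix.zero_apply]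
      congr 1 <;> ring
    rw [hw0]
    exact φ.rot_mem_U2_of_c_zero (by norm_num) hr (by rw [frfun, abs_zero, mul_zero, zero_div, zero_div, add_zero]; exact zero_lt_one)

omit [Fintype d] [DecidableEq d] in
/-- Barycentres of laminates with atoms in a convex set lie in the set. [folklore] -/
theorem _root_.Literature.Analysis.FluidPDE.StationaryEuler.Laminate.bary_mem_of_convex [Fintype d] [DecidableEq d]
    {S : Set (State d)} (hS : Convex ℝ S) {T : Laminate d} (hT : T.WeightsIn) (hA : T.AllAtoms (· ∈ S)) : T.bary ∈ S := by
  induction T with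
  | atom w => exact hA
  | split t η q l r ihl ihr =>
    rw [Laminate.bary_split]
    exact hS (ihl hT.2.2.1 hA.1) (ihr hT.2.2.2 hA.2) hT.1 (by linarith [hT.2.1]) (by ring)

/-- **`𝒱_r ⊆ 𝒦_r^{co}`**: a point of `𝒱_r` is the barycentre of a laminate with atoms in `𝒦_r`
(Prop. 14 (iv) at level `r`), and `C_r ⊇ 𝒦_r` is convex. [cite: ChoffrutSzekelyhidi2014, §5.3] -/
theorem calV_subset_C {r : ℝ} : φ.calV r ⊆ C r := by
  haveI : Nonempty d := ⟨φ.i₀⟩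
  intro w hw
  obtain ⟨hadm, hρ0, hρr, hF⟩ := hw
  have hr : 0 < r := by linarith
  obtain ⟨κ, l, a, b, hκl, hw_eq, ha, hb⟩ := φ.rot_decomp hadm hρ0
  -- `f_r(a, b, ρ) = F_r(w) < 1`, hence `g_r(a, b, ρ) ≤ 0`
  have hf : frfun r a b (φ.rho w) < 1 := by
    have := φ.Ffun_rot hκl r a b hρ0.ne'
    rw [← hw_eq] at this
    rwa [← this]
  have hc : |φ.rho w| < r / 2 := by rw [abs_of_pos hρ0]; exact hρr
  have hA := Ac_pos hr hc
  have hB := Bc_pos hr hc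
  have hg : gfun r a b (φ.rho w) ≤ 0 := by
    rw [gfun_eq hr]
    have e1 : Real.sqrt r * |a| / (r / 2 + φ.rho w) = |a| / Ac r (φ.rho w) := by rw [Ac]; field_simp
    have e2 : Real.sqrt r * |b| / (r / 2 - φ.rho w) = |b| / Bc r (φ.rho w) := by rw [Bc]; field_simp
    rw [frfun, e1, e2, div_add_div _ _ hA.ne' hB.ne', div_lt_one (mul_pos hA hB)] at hf
    nlinarith [hr]
  obtain ⟨T, hT, hbary, hK⟩ := φ.exists_planarLaminate hκl hr hc hg
  rw [hw_eq, ← hbary]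
  exact Laminate.bary_mem_of_convex (convex_C r) hT.weightsIn (hK.mono fun x hx => K_subset_C r hx)

/-- **`𝒰_r ⊆ 𝒦_r^{co}`.** [cite: ChoffrutSzekelyhidi2014, §2 (`𝒰 ⊂ 𝒦^{co}`)] -/
theorem U2_subset_C (r : ℝ) : φ.U2 r ⊆ C r := lcHull_subset_of_convex (convex_C r) φ.calV_subset_C

end Frame2

end StationaryEuler

end Literature.Analysis.FluidPDE
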